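import Literature.NumberTheory.Automorphic.UnitaryGroupDoubledIntegralWitness
import HarnessLib

/-!
# The integral big cell of `GL_{2n}` relative to a maximal parabolic: field and valued-field witnesses
# ([GelbartRogawski1991, §3.1 (3.1.3)]; [Borel1991, §14.21]; [BernsteinZelevinsky1976, §3.13])

Topic `NumberTheory/Automorphic`; namespace `Literature.NumberTheory.Automorphic.GLBigCell`.  KERNEL only: proved
lemmas; no named fact, no `sorry`.

For `g = [[a, b], [c, d]] ∈ GL_{ι ⊕ ι}(K)` and the maximal parabolic `P` of block-upper-triangular matrices with
unipotent radical `N = {n⁺(y) = [[1, y], [0, 1]]}` (ALL `y ∈ M_ι(K)`) and Weyl representative `s = antidiag(1, 1)`, the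
big cell is `Ω = {g ∣ g₁₁ invertible} = N⁻ P`.  We prove:
* (`exists_isUnit_block₁₁_add_mul`, ANY field `K`) **for every `g ∈ GL_{ι⊕ι}(K)` there is `y ∈ M_ι(K)` with `g₁₁ + y g₂₁`
  invertible** (`n⁺(y) g ∈ Ω`).  Proof (linear algebra): `x ↦ (a x, c x)` is injective; with `U = ker a`, a complement
  `V₃` of `range a` has `dim V₃ = dim U` (rank–nullity); put `y = φ ∘ (c|_U)⁻¹ ∘ pr_{c(U)}` for an isomorphism
  `φ : U ≅ V₃` and a projection `pr_{c(U)}` onto `c(U)`; then `a x + y(c x) = 0` forces `a x = 0 = y (c x)` (the sum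
  `range a ⊕ V₃` is direct), so `x ∈ U`, `y(c x) = φ x = 0`, `x = 0`.
* (`exists_integral_valuation_det_block₁₁_add_mul_eq_one`, `K` with a valuative relation) **for every
  `Y ∈ GL_{ι⊕ι}(𝒪)` (integral with integral inverse) there is an INTEGRAL `y` with `det (Y₁₁ + y Y₂₁) ∈ 𝒪^×`**: reduce
  modulo `𝓂` (`IntegralMatrixReduction`), take the field witness over `𝓀`, lift it arbitrarily.
This is the `GL`-analogue (used at the SPLIT places, where the doubled unitary group is `GL_{2n}(E_w)`) of
`UnitaryGroupDoubledIntegralWitness` (non-split places), for the unramified clause of the [GelbartRogawski1991, Prop.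
3.1.1] kernel construction (stage-1 cell `pub-hodgecm`, seat GR-1, brick L7s, 2026-08-21).

## References

* S. Gelbart, J. Rogawski, Invent. Math. 105 (1991) 445–472, §3.1 (3.1.3) [GelbartRogawski1991].
* A. Borel, *Linear Algebraic Groups*, 2nd ed., GTM 126 (1991), §14.21 [Borel1991].
* I. N. Bernstein, A. V. Zelevinsky, Russian Math. Surveys 31:3 (1976), §3.13 [BernsteinZelevinsky1976].
-/

set_option autoImplicit false

noncomputable section

open scoped Matrix MatrixGroups ValuativeRel
open Matrix ValuativeRel
open Literature.NumberTheory.Automorphic.IntegralReduction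

namespace Literature.NumberTheory.Automorphic.GLBigCell

variable {K : Type*} [Field K] {ι : Type*} [Fintype ι] [DecidableEq ι]

/-! ## §1 The field witness -/

/-- **linear-algebra core**: for linear maps `a c : W → V` between finite-dimensional spaces of the same dimension
with `ker a ⊓ ker c = ⊥`, there is `y : V → V` with `a + y ∘ c` injective. [cite: Borel1991, §14.21 (the big cell)] -/
theorem exists_injective_add_comp {V W : Type*} [AddCommGroup V] [Module K V] [FiniteDimensional K V]
    [AddCommGroup W] [Module K W] [FiniteDimensional K W] (hVW : Module.finrank K V = Module.finrank K W)
    (a c : W →ₗ[K] V) (hac : ∀ x, a x = 0 → c x = 0 → x = 0) :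
    ∃ y : V →ₗ[K] V, Function.Injective (a + y.comp c) := by
  -- `U = ker a`; `c` is injective on `U`
  set U : Submodule K W := LinearMap.ker a with hU
  set cU : U →ₗ[K] V := c.comp U.subtype with hcU
  have hcUi : Function.Injective cU := by
    intro x x' h
    apply Subtype.ext
    have h0 : c ((x : W) - (x' : W)) = 0 := by
      have := congrArg (fun z => z) h
      simp only [hcU, LinearMap.comp_apply, Submodule.subtype_apply] at this
      rw [map_sub, this, sub_self]
    have ha0 : a ((x : W) - (x' : W)) = 0 := by
      have hx : a x = 0 := x.2
      have hx' : a x' = 0 := x'.2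
      rw [map_sub, hx, hx', sub_self]
    exact sub_eq_zero.1 (hac _ ha0 h0)
  -- complements: `V₂` of `c(U)`, `V₃` of `range a`
  obtain ⟨V₂, hV₂⟩ := Submodule.exists_isCompl (LinearMap.range cU)
  obtain ⟨V₃, hV₃⟩ := Submodule.exists_isCompl (LinearMap.range a)
  -- `dim U = dim V₃`
  have hdim : Module.finrank K U = Module.finrank K V₃ := by
    have h1 := LinearMap.finrank_range_add_finrank_ker a
    have h2 := Submodule.finrank_sup_add_finrank_inf_eq (LinearMap.range a) V₃
    rw [hV₃.sup_eq_top, hV₃.inf_eq_bot, finrank_top, finrank_bot, add_zero] at h2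
    rw [hU]; omega
  -- the map `y = V₃.subtype ∘ φ ∘ (c|_U)⁻¹ ∘ pr_{c(U)}`
  set φ : U ≃ₗ[K] V₃ := LinearEquiv.ofFinrankEq U V₃ hdim with hφ
  set ψ : U ≃ₗ[K] LinearMap.range cU := LinearEquiv.ofInjective cU hcUi with hψ
  set P : V →ₗ[K] LinearMap.range cU := Submodule.projectionOnto (LinearMap.range cU) V₂ hV₂ with hP
  refine ⟨V₃.subtype.comp (φ.toLinearMap.comp (ψ.symm.toLinearMap.comp P)), fun x x' hxx' => ?_⟩
  -- injectivity: reduce to the kernel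
  rw [← sub_eq_zero]
  set z := x - x' with hz
  have hz0 : (a + (V₃.subtype.comp (φ.toLinearMap.comp (ψ.symm.toLinearMap.comp P))).comp c) z = 0 := by
    rw [hz, map_sub, hxx', sub_self]
  simp only [LinearMap.add_apply, LinearMap.comp_apply, LinearEquiv.coe_toLinearMap, Submodule.subtype_apply] at hz0
  -- `a z ∈ range a`, the other summand in `V₃`; the sum is direct
  have hdisj := hV₃.disjoint
  have haz : a z = 0 := by
    have hmem : a z ∈ LinearMap.range a ⊓ V₃ := by
      refine ⟨LinearMap.mem_range_self a z, ?_⟩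
      have : a z = -((φ (ψ.symm (P (c z))) : V)) := eq_neg_of_add_eq_zero_left hz0
      rw [this]
      exact V₃.neg_mem (φ (ψ.symm (P (c z)))).2
    rw [hdisj.eq_bot, Submodule.mem_bot] at hmem
    exact hmem
  have hyz : ((φ (ψ.symm (P (c z)))) : V) = 0 := by rw [haz, zero_add] at hz0; exact hz0
  -- `z ∈ U`, so `P (c z) = ψ z` and `φ z = 0`
  have hzU : z ∈ U := haz
  have hPcz : P (c z) = ψ ⟨z, hzU⟩ := by
    have hcz : c z ∈ LinearMap.range cU := ⟨⟨z, hzU⟩, rfl⟩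
    have h1 : P (c z) = ⟨c z, hcz⟩ := by
      rw [hP]
      exact Submodule.projectionOnto_apply_left hV₂ ⟨c z, hcz⟩
    rw [h1]
    apply Subtype.ext
    rw [hψ, LinearEquiv.ofInjective_apply]
    rfl
  rw [hPcz, LinearEquiv.symm_apply_apply] at hyz
  have : (⟨z, hzU⟩ : U) = 0 := by
    have h := (Submodule.coe_eq_zero).1 hyz
    exact φ.map_eq_zero_iff.1 h
  exact congrArg Subtype.val this

/-- **moving an element of `GL_{ι⊕ι}(K)` into the big cell by `N`**: for every invertible block matrix
`g = [[a, b], [c, d]]` over a field there is `y` with `a + y c` invertible. [cite: Borel1991, §14.21; BernsteinZelevinsky1976, §3.13] -/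
theorem exists_isUnit_block₁₁_add_mul (g : Matrix (ι ⊕ ι) (ι ⊕ ι) K) (hg : IsUnit g) :
    ∃ y : Matrix ι ι K, IsUnit (g.toBlocks₁₁ + y * g.toBlocks₂₁) := by
  have hac : ∀ x, Matrix.toLin' g.toBlocks₁₁ x = 0 → Matrix.toLin' g.toBlocks₂₁ x = 0 → x = 0 := by
    intro x hax hcx
    rw [Matrix.toLin'_apply] at hax hcx
    have hinj := Matrix.mulVec_injective_iff_isUnit.2 hg
    have h0 : g *ᵥ Sum.elim x 0 = g *ᵥ 0 := by
      rw [Matrix.mulVec_zero, ← Matrix.fromBlocks_toBlocks g, Matrix.fromBlocks_mulVec]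
      funext i
      cases i with
      | inl i => simpa using congrFun hax i
      | inr i => simpa using congrFun hcx i
    have := hinj h0
    funext i
    simpa using congrFun this (Sum.inl i)
  obtain ⟨y, hy⟩ := exists_injective_add_comp rfl (Matrix.toLin' g.toBlocks₁₁) (Matrix.toLin' g.toBlocks₂₁) hac
  refine ⟨LinearMap.toMatrix' y, ?_⟩
  refine Matrix.mulVec_injective_iff_isUnit.1 fun u u' huu' => hy ?_
  simp only [LinearMap.add_apply, LinearMap.comp_apply, Matrix.toLin'_apply]
  have e : ∀ z : ι → K, (g.toBlocks₁₁ + LinearMap.toMatrix' y * g.toBlocks₂₁) *ᵥ z = g.toBlocks₁₁ *ᵥ z + y (g.toBlocks₂₁ *ᵥ z) := by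
    intro z
    rw [Matrix.add_mulVec, ← Matrix.mulVec_mulVec, ← Matrix.toLin'_apply (LinearMap.toMatrix' y), Matrix.toLin'_toMatrix']
  rw [← e, ← e]
  exact huu'

/-! ## §2 The integral witness over a valued field -/

section Valued

variable [ValuativeRel K]

/-- **the integral big cell of `GL_{2n}`**: for `Y ∈ GL_{ι⊕ι}(𝒪)` (integral with integral inverse `Y'`) there is an
INTEGRAL `y` with `det (Y₁₁ + y Y₂₁) ∈ 𝒪^×` — i.e. `s n⁺(y) Y ∈ P(𝒪) · s · N(𝒪)`. Reduce modulo `𝓂`, take the field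
witness, lift. [cite: GelbartRogawski1991, §3.1 (3.1.3); BernsteinZelevinsky1976, §3.13] -/
theorem exists_integral_valuation_det_block₁₁_add_mul_eq_one {Y Y' : Matrix (ι ⊕ ι) (ι ⊕ ι) K}
    (hYi : ValBound 1 Y) (hY'i : ValBound 1 Y') (hYY' : Y * Y' = 1) :
    ∃ y : Matrix ι ι K, ValBound 1 y ∧ valuation K (Y.toBlocks₁₁ + y * Y.toBlocks₂₁).det = 1 := by
  have hYu : IsUnit (redMat Y) := DoubledUnitary.isUnit_redMat_of_mul_eq_one hYi hY'i hYY'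
  obtain ⟨yb, hyb⟩ := exists_isUnit_block₁₁_add_mul (redMat Y) hYu
  rw [redMat_toBlocks₁₁, redMat_toBlocks₂₁] at hyb
  -- lift `yb`
  obtain ⟨y₀, hy₀⟩ : ∃ y₀ : Matrix ι ι 𝒪[K], (IsLocalRing.residue 𝒪[K]).mapMatrix y₀ = yb :=
    ⟨yb.map (Function.surjInv IsLocalRing.residue_surjective), by
      ext i j; exact Function.surjInv_eq IsLocalRing.residue_surjective (yb i j)⟩
  refine ⟨(𝒪[K]).subtype.mapMatrix y₀, fun i j => (Valuation.mem_integer_iff _ _).1 (y₀ i j).2, ?_⟩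
  have hyi : ValBound 1 ((𝒪[K]).subtype.mapMatrix y₀) := fun i j => (Valuation.mem_integer_iff _ _).1 (y₀ i j).2
  obtain ⟨hAi, -, hCi, -⟩ := valBound_toBlocks hYi
  have hyC : ValBound 1 ((𝒪[K]).subtype.mapMatrix y₀ * Y.toBlocks₂₁) := by
    have := hyi.mul hCi; rwa [one_mul] at this
  refine valuation_eq_one_of_red_ne_zero ((Valuation.mem_integer_iff _ _).2 (valuation_det_le_one (hAi.add hyC))) ?_
  rw [red_det (hAi.add hyC), redMat_add hAi hyC, redMat_mul hyi hCi, redMat_mapMatrix, hy₀]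
  exact (Matrix.isUnit_iff_isUnit_det _ |>.1 hyb).ne_zero

end Valued

end Literature.NumberTheory.Automorphic.GLBigCell

end
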